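import Summits.ResolutionOfSingularities.ResolutionOfSingularities.Theorems.PurelyInseparableDim4ChartChainStep
import Summits.ResolutionOfSingularities.ResolutionOfSingularities.Theorems.PurelyInseparableDim4ChartCover
import Literature.AlgebraicGeometry.Resolution.BlowupSequencesBoundarySuperset
import Literature.AlgebraicGeometry.Resolution.KollarMaxContactPersistence
import Literature.AlgebraicGeometry.Resolution.MaximalContactPersistence
import HarnessLib

/-!
# Purely inseparable four-folds `z^p + F(x₁, …, x₄)`: the BOUNDARY SHAPE along monotone coordinate chains —
# the simple-normal-crossings input of the chain step, DISCHARGED (brick TY-2 (h) part 6a of cell `res-dim4-pi`)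

[OURS · counted 0] (D-0157 DOOR 2; director-resolution DR-157-C; frame `PIDim4.TerminationImpliesOrderReduction`,
S3 (c); desk caveat FC-1 «boundary amnesia»). Sequel of `PurelyInseparableDim4ChartChainStep.lean`. There the
induction step `coord_chain_step` took as HYPOTHESIS the simple normal crossings of the boundary, read on the
chart, with the next centre `V(z, x_{S'})` — in general not derivable from the walk's presented state (FC-1).
Along FULLY MONOTONE chains (`S ⊆ S' ⊆ S'' ⊆ …`: every centre contains all variables of the previous one,
chart variable included) it IS derivable, from the following SHAPE of the boundary relative to the chart `φ` and
the next centre `S'`: every boundary member EITHER reads a coordinate hyperplane `V(xᵢ)` with `i ∈ S'` on the chart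
(it contains the next centre) OR misses `φ(V(z, x_{S'}))` altogether. PROVED here (no `sorry`, no new axiom):

* §1 `image_CΛ_chart_of_chart_subset_preimage` — on the chart of the chart, `φ''(V(z, x_{S''})) ⊆ π₂⁻¹ φ(V(z, x_{S'}))`
  (`j' ∈ S''`); `comap_strictTransformIdeal_chart_of_chart` — strict transforms under the blow-up of the global
  centre, read on the chart of the chart, are the strict transforms under the restricted blow-up of `𝔸⁵`;
  hence `comap_strictTransformIdeal_hyperplane_chart_of_chart` (`V(xᵢ) ↦ V(xᵢ + b'ᵢ)`, `i ≠ j'`) and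
  `comap_strictTransformIdeal_hyperplane_self_chart_of_chart` (`V(x_{j'}) ↦ ⊤`), from the one-level dictionary
  `PurelyInseparableDim4ChartBoundary.lean`;
* §2 **`hasSNCWith_globalCentre_of_shape`** — SHAPE + `HasSNC E` + closedness ⇒ `HasSNCWith E Z_c` (the FC-1 input),
  by the tree's `HasSNCWith.of_disjoint` (Kollár 3.104) and `hasSNCWith_coordHyperplanes_𝓘Λ`;
* §3 **`shape_transform`** — SHAPE PROPAGATES along a step with `S' ⊆ S''`: the transformed boundary
  `E.map σˢ ++ [π₂^* Z_c]` has the shape relative to the chart of the chart and `S''` (new exceptional: `V(x_{j'})`,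
  `j' ∈ S' ⊆ S''`; an old `V(xᵢ)`, `i ∈ S'`: `⊤` if `i = j'`, `V(xᵢ)` if `b'ᵢ = 0`, else the translated `V(xᵢ + b'ᵢ)`
  which MISSES `V(z, x_{S''})` as `i ∈ S''`; a member missing `φ(V(z, x_{S'}))` keeps missing, supports of strict
  transforms lying over the support).

The sequel `PurelyInseparableDim4ChartChainMonotone.lean` assembles the unconditional monotone chain. Nothing
here is a statement about resolution of singularities in dimension ≥ 4 / characteristic `p` (NOT proved anywhere
in this programme). bears_on: LADDER-RESOLUTION:D157-DOOR2 (res-dim4-pi). Supports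
stmt-ResolutionOfSingularities-16155 (helper, TY-2 (h)).
-/

-- every declaration of this summit lives under `Summit.ResolutionOfSingularities.ResolutionOfSingularities`
-- (summit = problem), which the duplicate-namespace linter flags; house convention (cf. the Target file).
set_option linter.dupNamespace false

noncomputable section

open MvPolynomial Finset CategoryTheory AlgebraicGeometry Opposite TopologicalSpace
open AlgebraicGeometry.Scheme.IdealSheafData (ofIdealTop vanishingIdeal)

namespace Summit.ResolutionOfSingularities.ResolutionOfSingularities.Theorems.PIDim4

open Literature.AlgebraicGeometry.Resolution
open Literature.AlgebraicGeometry.Resolution.AffinePointBlowup (P A γ coord Wtop)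

namespace ChartDictionary

/-! ## §1 The chart of the chart: image of the next centre, strict transforms -/

section ChartOfChart

variable {K : Type} [Field K] {Z W₂ : Scheme.{0}} (φ : P 4 K ⟶ Z) [IsOpenImmersion φ] {π₂ : W₂ ⟶ Z}
  {S' S'' : Finset (Fin 4)} {j' : Fin 4}

/-- **The next centre lies over the previous one**: if `j' ∈ S''` then on the chart of the chart
`φ''(V(z, x_{S''})) ⊆ π₂⁻¹ φ(V(z, x_{S'}))` (the next centre lies in the newest exceptional divisor). -/
theorem image_CΛ_chart_of_chart_subset_preimage
    (hT : IsClosed (φ '' (AffineCoordBlowup.CΛ 4 K (insert 0 (Fin.succ '' (S' : Set (Fin 4)))) : Set (P 4 K))))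
    (hπ₂ : IsBlowup π₂ (vanishingIdeal (closureImage φ
      ((AffineCoordBlowup.𝓘Λ 4 K (insert 0 (Fin.succ '' (S' : Set (Fin 4))))).support : Set (P 4 K)))))
    (hj' : j' ∈ S') (Θ' : A 4 K →+* A 4 K) [IsIso (CommRingCat.ofHom Θ')] (hΘ'j : Θ' (X j'.succ) = X j'.succ)
    (hj'' : j' ∈ S'') :
    (Spec.map (CommRingCat.ofHom Θ') ≫
        AffineCoordBlowup.chartImm (isBlowup_restrict_globalCentre φ _ hπ₂) (succ_mem_centreVars hj') ≫
          (π₂ ⁻¹ᵁ φ.opensRange).ι) ''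
      (AffineCoordBlowup.CΛ 4 K (insert 0 (Fin.succ '' (S'' : Set (Fin 4)))) : Set (P 4 K)) ⊆
      π₂ ⁻¹' (φ '' (AffineCoordBlowup.CΛ 4 K (insert 0 (Fin.succ '' (S' : Set (Fin 4)))) : Set (P 4 K))) := by
  have hle : ofIdealTop (Ideal.span {coord 4 K j'.succ}) ≤
      AffineCoordBlowup.𝓘Λ 4 K (insert 0 (Fin.succ '' (S'' : Set (Fin 4)))) :=
    ofIdealTop_span_le_𝓘Λ (Ideal.subset_span ⟨j'.succ, Set.mem_insert_of_mem _ ⟨j', hj'', rfl⟩, rfl⟩)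
  have hsupp : AffineCoordBlowup.CΛ 4 K (insert 0 (Fin.succ '' (S'' : Set (Fin 4)))) ≤
      (((vanishingIdeal (closureImage φ ((AffineCoordBlowup.𝓘Λ 4 K
        (insert 0 (Fin.succ '' (S' : Set (Fin 4))))).support : Set (P 4 K)))).comap π₂).comap
        (Spec.map (CommRingCat.ofHom Θ') ≫
          AffineCoordBlowup.chartImm (isBlowup_restrict_globalCentre φ _ hπ₂) (succ_mem_centreVars hj') ≫
            (π₂ ⁻¹ᵁ φ.opensRange).ι)).support := by
    rw [comap_comap_globalCentre_chart_of_chart φ hj' hΘ'j hπ₂]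
    exact Scheme.IdealSheafData.le_support_iff_le_vanishingIdeal.mpr hle
  rintro _ ⟨y, hy, rfl⟩
  have h3 := hsupp hy
  rw [Scheme.IdealSheafData.support_comap, Scheme.IdealSheafData.support_comap] at h3
  have h4 : π₂ ((Spec.map (CommRingCat.ofHom Θ') ≫
      AffineCoordBlowup.chartImm (isBlowup_restrict_globalCentre φ _ hπ₂) (succ_mem_centreVars hj') ≫
        (π₂ ⁻¹ᵁ φ.opensRange).ι) y) ∈
      ((vanishingIdeal (closureImage φ ((AffineCoordBlowup.𝓘Λ 4 K
        (insert 0 (Fin.succ '' (S' : Set (Fin 4))))).support : Set (P 4 K)))).support : Set Z) := h3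
  rwa [coe_support_globalCentre φ hT] at h4

/-- **Strict transforms on the chart of the chart are strict transforms under the restricted blow-up of `𝔸⁵`**:
`(σˢ_{π₂, Z_c} D)|_{φ''} = (σˢ_{ρ, V(z, x_{S'})} (D|_φ))|_{Spec Θ' ≫ chartImm}`, `ρ = (π₂ |_{φ(𝔸⁵)}) ≫ e` (strict
transforms commute with the flat base change `π₂⁻¹ φ(𝔸⁵) ↪ W₂`, Görtz–Wedhorn (13.19)). -/
theorem comap_strictTransformIdeal_chart_of_chart [IsLocallyNoetherian Z] (Λ' : Set (Fin (4 + 1)))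
    (hπ₂ : IsBlowup π₂ (vanishingIdeal (closureImage φ ((AffineCoordBlowup.𝓘Λ 4 K Λ').support : Set (P 4 K)))))
    {i' : Fin (4 + 1)} (hi' : i' ∈ Λ') (g : P 4 K ⟶ P 4 K) (D : Z.IdealSheafData) :
    (strictTransformIdeal π₂ (vanishingIdeal (closureImage φ
        ((AffineCoordBlowup.𝓘Λ 4 K Λ').support : Set (P 4 K)))) D).comap
        (g ≫ AffineCoordBlowup.chartImm (isBlowup_restrict_globalCentre φ _ hπ₂) hi' ≫ (π₂ ⁻¹ᵁ φ.opensRange).ι) =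
      (strictTransformIdeal ((π₂ ∣_ φ.opensRange) ≫ φ.isoOpensRange.symm.hom)
        (AffineCoordBlowup.𝓘Λ 4 K Λ') (D.comap φ)).comap
        (g ≫ AffineCoordBlowup.chartImm (isBlowup_restrict_globalCentre φ _ hπ₂) hi') := by
  haveI : IsProper π₂ := hπ₂.isProper
  haveI : IsLocallyNoetherian W₂ := LocallyOfFiniteType.isLocallyNoetherian π₂
  have hι : φ.isoOpensRange.inv ≫ φ = φ.opensRange.ι := by
    rw [Iso.inv_comp_eq, Scheme.Hom.isoOpensRange_hom_ι]
  have key : ∀ I : Z.IdealSheafData, I.comap φ.opensRange.ι = (I.comap φ).comap φ.isoOpensRange.symm.hom := by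
    intro I
    rw [Iso.symm_hom, ← Scheme.IdealSheafData.comap_comp, hι]
  have hrestr : (strictTransformIdeal π₂ (vanishingIdeal (closureImage φ
      ((AffineCoordBlowup.𝓘Λ 4 K Λ').support : Set (P 4 K)))) D).comap (π₂ ⁻¹ᵁ φ.opensRange).ι =
      strictTransformIdeal ((π₂ ∣_ φ.opensRange) ≫ φ.isoOpensRange.symm.hom)
        (AffineCoordBlowup.𝓘Λ 4 K Λ') (D.comap φ) := by
    rw [← strictTransformIdeal_morphismRestrict, key, key, comap_globalCentre φ Λ', strictTransformIdeal,
      strictTransformIdeal]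
    simp_rw [Scheme.IdealSheafData.comap_comp]
  rw [← Category.assoc, Scheme.IdealSheafData.comap_comp, hrestr]

/-- **An old hyperplane `V(xᵢ)`, `i ≠ j'`, reads `V(xᵢ + b'ᵢ)` on the chart of the chart** (re-centring `Θ'` with
`Θ' xᵢ = xᵢ + b'ᵢ`). -/
theorem comap_strictTransformIdeal_hyperplane_chart_of_chart [IsLocallyNoetherian Z] (hj' : j' ∈ S')
    (hπ₂ : IsBlowup π₂ (vanishingIdeal (closureImage φ
      ((AffineCoordBlowup.𝓘Λ 4 K (insert 0 (Fin.succ '' (S' : Set (Fin 4))))).support : Set (P 4 K)))))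
    {Θ' : A 4 K →+* A 4 K} {b' : Fin 4 → K} {i : Fin 4} (hij : i ≠ j') (hΘ'i : Θ' (X i.succ) = X i.succ + C (b' i))
    {D : Z.IdealSheafData} (hD : D.comap φ = ofIdealTop (Ideal.span {coord 4 K i.succ})) :
    (strictTransformIdeal π₂ (vanishingIdeal (closureImage φ
        ((AffineCoordBlowup.𝓘Λ 4 K (insert 0 (Fin.succ '' (S' : Set (Fin 4))))).support : Set (P 4 K)))) D).comap
        (Spec.map (CommRingCat.ofHom Θ') ≫
          AffineCoordBlowup.chartImm (isBlowup_restrict_globalCentre φ _ hπ₂) (succ_mem_centreVars hj') ≫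
            (π₂ ⁻¹ᵁ φ.opensRange).ι) =
      ofIdealTop (Ideal.span {(γ 4 K).symm (X i.succ + C (b' i))}) := by
  rw [comap_strictTransformIdeal_chart_of_chart φ _ hπ₂, hD]
  exact comap_hyperplane_chart hj' hij hΘ'i (isBlowup_restrict_globalCentre φ _ hπ₂)

/-- **The old hyperplane `V(x_{j'})` misses the chart of the chart.** -/
theorem comap_strictTransformIdeal_hyperplane_self_chart_of_chart [IsLocallyNoetherian Z] (hj' : j' ∈ S')
    (hπ₂ : IsBlowup π₂ (vanishingIdeal (closureImage φ
      ((AffineCoordBlowup.𝓘Λ 4 K (insert 0 (Fin.succ '' (S' : Set (Fin 4))))).support : Set (P 4 K)))))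
    (Θ' : A 4 K →+* A 4 K) {D : Z.IdealSheafData} (hD : D.comap φ = ofIdealTop (Ideal.span {coord 4 K j'.succ})) :
    (strictTransformIdeal π₂ (vanishingIdeal (closureImage φ
        ((AffineCoordBlowup.𝓘Λ 4 K (insert 0 (Fin.succ '' (S' : Set (Fin 4))))).support : Set (P 4 K)))) D).comap
        (Spec.map (CommRingCat.ofHom Θ') ≫
          AffineCoordBlowup.chartImm (isBlowup_restrict_globalCentre φ _ hπ₂) (succ_mem_centreVars hj') ≫
            (π₂ ⁻¹ᵁ φ.opensRange).ι) = ⊤ := by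
  rw [comap_strictTransformIdeal_chart_of_chart φ _ hπ₂, hD]
  exact comap_hyperplane_self_chart hj' Θ' (isBlowup_restrict_globalCentre φ _ hπ₂)

/-- The support of a strict transform lies over the support. -/
theorem support_strictTransformIdeal_subset_preimage {X X' : Scheme.{0}} [IsLocallyNoetherian X'] (π : X' ⟶ X)
    (C H : X.IdealSheafData) : ((strictTransformIdeal π C H).support : Set X') ⊆ π ⁻¹' H.support :=
  (support_strictTransformIdeal_subset (π := π) (C := C) H).trans
    (support_controlledTransform_subset_preimage (π := π) (C := C) H 1)

end ChartOfChart

/-! ## §2 The boundary shape gives the simple-normal-crossings input -/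

section Shape

variable {K : Type} [Field K] {Z W₂ : Scheme.{0}} (φ : P 4 K ⟶ Z) [IsOpenImmersion φ] {π₂ : W₂ ⟶ Z}
  {S' S'' : Finset (Fin 4)} {j' : Fin 4}

/-- A translated coordinate hyperplane `V(xᵢ + c)`, `c ≠ 0`, misses every coordinate subspace `V(x_Λ)` with `xᵢ`
among its variables. -/
theorem support_translate_inter_CΛ_eq_empty {i : Fin 4} {c : K} (hc : c ≠ 0) {Λ : Set (Fin (4 + 1))} (hi : i.succ ∈ Λ) :
    ((ofIdealTop (Ideal.span {(γ 4 K).symm (X i.succ + C c)})).support : Set (P 4 K)) ∩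
      (AffineCoordBlowup.CΛ 4 K Λ : Set (P 4 K)) = ∅ := by
  rw [Set.eq_empty_iff_forall_notMem]
  rintro y ⟨hy1, hy2⟩
  rw [SetLike.mem_coe, ofIdealTop_span_γ_symm_eq_shf,
    Literature.AlgebraicGeometry.Hironaka2017.SpecOrders.mem_support_shf_iff, Ideal.span_singleton_le_iff_mem] at hy1
  have hxi : (X i.succ : A 4 K) ∈ y.asIdeal := (AffineCoordBlowup.mem_CΛ_iff' 4 K Λ y).mp hy2 i.succ hi
  have hC : (C c : A 4 K) ∈ y.asIdeal := by simpa using y.asIdeal.sub_mem hy1 hxi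
  exact y.isPrime.ne_top ((Ideal.eq_top_iff_one _).mpr (by
    simpa [← C_mul, inv_mul_cancel₀ hc] using y.asIdeal.mul_mem_left (C c⁻¹) hC))

/-- **SHAPE ⇒ the FC-1 input.** If `E` has simple normal crossings on `Z`, `φ(V(z, x_{S'}))` is closed, and every member
of `E` either reads a coordinate hyperplane `V(xᵢ)` on the chart or misses `φ(V(z, x_{S'}))`, then `E` has simple normal
crossings with the global centre `Z_c` (members through a point of the centre are coordinate hyperplanes on the
chart, `hasSNCWith_coordHyperplanes_𝓘Λ`; the others are disjoint from it, `HasSNCWith.of_disjoint`). -/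
theorem hasSNCWith_globalCentre_of_shape
    (hT : IsClosed (φ '' (AffineCoordBlowup.CΛ 4 K (insert 0 (Fin.succ '' (S' : Set (Fin 4)))) : Set (P 4 K))))
    {E : List Z.IdealSheafData} (hE : HasSNC E)
    (hshape : ∀ D ∈ E, (∃ i : Fin 4, D.comap φ = ofIdealTop (Ideal.span {coord 4 K i.succ})) ∨
      ((D.support : Set Z) ∩ φ '' (AffineCoordBlowup.CΛ 4 K (insert 0 (Fin.succ '' (S' : Set (Fin 4)))) : Set (P 4 K)) = ∅)) :
    HasSNCWith E (vanishingIdeal (closureImage φ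
      ((AffineCoordBlowup.𝓘Λ 4 K (insert 0 (Fin.succ '' (S' : Set (Fin 4))))).support : Set (P 4 K)))) := by
  classical
  -- the sub-list of the members which are coordinate hyperplanes on the chart
  set E' := E.filter (fun D => decide (∃ i : Fin 4, D.comap φ = ofIdealTop (Ideal.span {coord 4 K i.succ}))) with hE'
  have hmemE' : ∀ D, D ∈ E' ↔ D ∈ E ∧ ∃ i : Fin 4, D.comap φ = ofIdealTop (Ideal.span {coord 4 K i.succ}) := by
    intro D
    rw [hE', List.mem_filter, decide_eq_true_iff]
  have hE'snc : HasSNC E' := HasSNC.of_subset (fun D hD => ((hmemE' D).mp hD).1) hE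
  -- its restriction to the chart is a list of coordinate hyperplanes
  let idx : Z.IdealSheafData → Fin (4 + 1) := fun D =>
    if h : ∃ i : Fin 4, D.comap φ = ofIdealTop (Ideal.span {coord 4 K i.succ}) then h.choose.succ else 0
  have hidx : ∀ D ∈ E', D.comap φ = ofIdealTop (Ideal.span {coord 4 K (idx D)}) := by
    intro D hD
    obtain ⟨-, h⟩ := (hmemE' D).mp hD
    simp only [idx, dif_pos h]
    exact h.choose_spec
  have hmap : E'.map (·.comap φ) = (E'.map idx).map (fun k => ofIdealTop (Ideal.span {coord 4 K k})) := by
    rw [List.map_map]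
    exact List.map_congr_left fun D hD => hidx D hD
  have hEc : HasSNCWith (E'.map (·.comap φ)) (AffineCoordBlowup.𝓘Λ 4 K (insert 0 (Fin.succ '' (S' : Set (Fin 4))))) := by
    rw [hmap]
    exact hasSNCWith_coordHyperplanes_𝓘Λ _ _
  refine HasSNCWith.of_disjoint (hasSNCWith_globalCentre φ hT hE'snc hEc) hE fun D hD hD' => ?_
  have h2 : ¬ ∃ i : Fin 4, D.comap φ = ofIdealTop (Ideal.span {coord 4 K i.succ}) := fun h => hD' ((hmemE' D).mpr ⟨hD, h⟩)
  rw [coe_support_globalCentre φ hT]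
  exact (hshape D hD).resolve_left h2

/-! ## §3 The shape propagates along a step with `S' ⊆ S''` -/

/-- **SHAPE PROPAGATION.** Let `φ(V(z, x_{S'}))` be closed, `π₂` any blowing up along `Z_c`, `j' ∈ S'`, `Θ'` a
re-centring (`Θ' xᵢ = xᵢ + b'ᵢ`, `b'_{j'} = 0`), `S' ⊆ S''`, and `E` a boundary with the (strong) shape relative to
`(φ, S')`: every member reads `V(xᵢ)` with `i ∈ S'` on the chart or misses `φ(V(z, x_{S'}))`. Then the transformed
boundary `E.map σˢ ++ [π₂^* Z_c]` has the shape relative to the chart of the chart `φ''` and `S''`. -/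
theorem shape_transform [IsLocallyNoetherian Z]
    (hT : IsClosed (φ '' (AffineCoordBlowup.CΛ 4 K (insert 0 (Fin.succ '' (S' : Set (Fin 4)))) : Set (P 4 K))))
    (hπ₂ : IsBlowup π₂ (vanishingIdeal (closureImage φ
      ((AffineCoordBlowup.𝓘Λ 4 K (insert 0 (Fin.succ '' (S' : Set (Fin 4))))).support : Set (P 4 K)))))
    (hj' : j' ∈ S') {b' : Fin 4 → K} (hbj' : b' j' = 0) {Θ' : A 4 K ≃ₐ[K] A 4 K}
    (hs' : ∀ i : Fin 4, Θ' (X i.succ) = X i.succ + C (b' i)) (hsub : S' ⊆ S'') {E : List Z.IdealSheafData}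
    (hshape : ∀ D ∈ E, (∃ i ∈ S', D.comap φ = ofIdealTop (Ideal.span {coord 4 K i.succ})) ∨
      ((D.support : Set Z) ∩ φ '' (AffineCoordBlowup.CΛ 4 K (insert 0 (Fin.succ '' (S' : Set (Fin 4)))) : Set (P 4 K)) = ∅)) :
    ∀ D₂ ∈ E.map (strictTransformIdeal π₂ (vanishingIdeal (closureImage φ
        ((AffineCoordBlowup.𝓘Λ 4 K (insert 0 (Fin.succ '' (S' : Set (Fin 4))))).support : Set (P 4 K))))) ++
      [(vanishingIdeal (closureImage φ
        ((AffineCoordBlowup.𝓘Λ 4 K (insert 0 (Fin.succ '' (S' : Set (Fin 4))))).support : Set (P 4 K)))).comap π₂],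
      (∃ i ∈ S'', D₂.comap (Spec.map (CommRingCat.ofHom (Θ' : A 4 K →+* A 4 K)) ≫
          AffineCoordBlowup.chartImm (isBlowup_restrict_globalCentre φ _ hπ₂) (succ_mem_centreVars hj') ≫
            (π₂ ⁻¹ᵁ φ.opensRange).ι) = ofIdealTop (Ideal.span {coord 4 K i.succ})) ∨
      ((D₂.support : Set W₂) ∩ (Spec.map (CommRingCat.ofHom (Θ' : A 4 K →+* A 4 K)) ≫
          AffineCoordBlowup.chartImm (isBlowup_restrict_globalCentre φ _ hπ₂) (succ_mem_centreVars hj') ≫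
            (π₂ ⁻¹ᵁ φ.opensRange).ι) ''
        (AffineCoordBlowup.CΛ 4 K (insert 0 (Fin.succ '' (S'' : Set (Fin 4)))) : Set (P 4 K)) = ∅) := by
  haveI : IsIso (CommRingCat.ofHom (Θ' : A 4 K →+* A 4 K)) :=
    (inferInstance : IsIso Θ'.toRingEquiv.toCommRingCatIso.hom)
  haveI : IsProper π₂ := hπ₂.isProper
  haveI : IsLocallyNoetherian W₂ := LocallyOfFiniteType.isLocallyNoetherian π₂
  have hs'' : ∀ i : Fin 4, (Θ' : A 4 K →+* A 4 K) (X i.succ) = X i.succ + C (b' i) := fun i => hs' i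
  have hΘ'j : (Θ' : A 4 K →+* A 4 K) (X j'.succ) = X j'.succ := by rw [hs'' j', hbj', C_0, add_zero]
  intro D₂ hD₂
  rw [List.mem_append, List.mem_map, List.mem_singleton] at hD₂
  rcases hD₂ with ⟨D, hD, rfl⟩ | rfl
  · rcases hshape D hD with ⟨i, hiS', hDi⟩ | hdisj
    · by_cases hij : i = j'
      · -- the old hyperplane `V(x_{j'})` misses the chart of the chart
        subst hij
        right
        have htop := comap_strictTransformIdeal_hyperplane_self_chart_of_chart φ hj' hπ₂ (Θ' : A 4 K →+* A 4 K) hDi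
        rw [Set.eq_empty_iff_forall_notMem]
        rintro _ ⟨hw1, y, hy, rfl⟩
        have h1 : y ∈ ((strictTransformIdeal π₂ (vanishingIdeal (closureImage φ ((AffineCoordBlowup.𝓘Λ 4 K
            (insert 0 (Fin.succ '' (S' : Set (Fin 4))))).support : Set (P 4 K)))) D).comap
            (Spec.map (CommRingCat.ofHom (Θ' : A 4 K →+* A 4 K)) ≫
              AffineCoordBlowup.chartImm (isBlowup_restrict_globalCentre φ _ hπ₂) (succ_mem_centreVars hj') ≫
                (π₂ ⁻¹ᵁ φ.opensRange).ι)).support := by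
          rw [Scheme.IdealSheafData.support_comap]; exact hw1
        rw [htop, Scheme.IdealSheafData.support_top] at h1
        exact h1
      · by_cases hb : b' i = 0
        · -- untranslated: still a coordinate hyperplane through the new origin
          left
          refine ⟨i, hsub hiS', ?_⟩
          rw [comap_strictTransformIdeal_hyperplane_chart_of_chart φ hj' hπ₂ hij (hs'' i) hDi, hb, C_0, add_zero]
          rfl
        · -- translated off: `V(xᵢ + b'ᵢ)` misses `V(z, x_{S''})` since `i ∈ S''`
          right
          rw [Set.eq_empty_iff_forall_notMem]
          rintro _ ⟨hw1, y, hy, rfl⟩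
          have h1 : y ∈ ((strictTransformIdeal π₂ (vanishingIdeal (closureImage φ ((AffineCoordBlowup.𝓘Λ 4 K
              (insert 0 (Fin.succ '' (S' : Set (Fin 4))))).support : Set (P 4 K)))) D).comap
              (Spec.map (CommRingCat.ofHom (Θ' : A 4 K →+* A 4 K)) ≫
                AffineCoordBlowup.chartImm (isBlowup_restrict_globalCentre φ _ hπ₂) (succ_mem_centreVars hj') ≫
                  (π₂ ⁻¹ᵁ φ.opensRange).ι)).support := by
            rw [Scheme.IdealSheafData.support_comap]; exact hw1
          rw [comap_strictTransformIdeal_hyperplane_chart_of_chart φ hj' hπ₂ hij (hs'' i) hDi] at h1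
          have h0 := support_translate_inter_CΛ_eq_empty (K := K) hb
            (Λ := insert 0 (Fin.succ '' (S'' : Set (Fin 4)))) (Set.mem_insert_of_mem _ ⟨i, hsub hiS', rfl⟩)
          exact (Set.eq_empty_iff_forall_notMem.mp h0) y ⟨h1, hy⟩
    · -- a member missing the old centre keeps missing the new one
      right
      rw [Set.eq_empty_iff_forall_notMem]
      rintro w ⟨hw1, hw2⟩
      have h1 : π₂ w ∈ (D.support : Set Z) := support_strictTransformIdeal_subset_preimage π₂ _ D hw1
      have h2 := image_CΛ_chart_of_chart_subset_preimage φ hT hπ₂ hj' (Θ' : A 4 K →+* A 4 K) hΘ'j (hsub hj') hw2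
      exact (Set.eq_empty_iff_forall_notMem.mp hdisj) (π₂ w) ⟨h1, h2⟩
  · -- the new exceptional divisor reads `V(x_{j'})`, `j' ∈ S' ⊆ S''`
    left
    exact ⟨j', hsub hj', comap_comap_globalCentre_chart_of_chart φ hj' hΘ'j hπ₂⟩

end Shape

end ChartDictionary

end Summit.ResolutionOfSingularities.ResolutionOfSingularities.Theorems.PIDim4

end
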